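import Mathlib
import Summits.MatrixMultiplication.MatrixMultiplication.Theorems.HiddenToeplitzCornersHiddenCornerLemmaRStein

/-!
# Toolkit E — dictionary between coefficient vectors `Fin N → ℂ` (with the up-shift `Zᵀ`)
# and polynomials of degree `< N` (with `divX`)

Support file for crux item `stmt-MatrixMultiplication-10752`
(`Summit.MatrixMultiplication.MatrixMultiplication.Theses.HiddenToeplitzCorners.HiddenCornerLemmaR`),
line `frobenius-dual-short-syzygies`, stub group TOOLKIT-E of the strip theorem /
`stub_gconstDualLaw` (paper proof `math/STRIP_THEOREM.md`, assembly step (S-f): it translates the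
matrix data of a hidden corner — the shift `Zᵀ`, the correlation operators
`U(μ) = Σ_i μ_i (Zᵀ)^i` and the standard pairing — into the polynomial toolkit A–D, where the
capacity inequality is proved).

Setting.  `toPoly : (Fin N → ℂ) →ₗ[ℂ] ℂ[X]` is the linear map `v ↦ Σ_{i<N} v i • X^i`, written
through Mathlib's `Polynomial.degreeLTEquiv` as
`(Polynomial.degreeLT ℂ N).subtype ∘ₗ (Polynomial.degreeLTEquiv ℂ N).symm.toLinearMap`.
`Z` is the lower shift on `Fin N → ℂ`, written verbatim as in the crux (`Z i j = [i = j + 1]`),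
so `Zᵀ` is the up-shift `(Zᵀ v) i = v (i + 1)` (`0` at the top index); `δ := Polynomial.divX`;
and a coefficient polynomial `α` acts on `f ∈ ℂ[X]` by `act α f := Σ_i coeff α i • δ^[i] f`,
written `Polynomial.lsum (fun i => LinearMap.smulRight LinearMap.id (δ^[i] f)) α` (toolkit D).
All statements below are in this expanded, notation-free (registered) form.

Results (folklore linear algebra):
* `hclR_coeff_toPoly` (E1): `coeff (toPoly v) i = v i` for `i < N` and `= 0` for `i ≥ N`;
* `hclR_toPoly_injective` (E2) and `hclR_range_toPoly` (E3): `toPoly` is a linear isomorphism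
  onto `degreeLT ℂ N`;
* `hclR_toPoly_shiftT_mulVec` (E4), `hclR_toPoly_shiftT_pow_mulVec` (E5):
  `toPoly ((Zᵀ)^m v) = δ^[m] (toPoly v)` — the up-shift of vectors is `divX` of polynomials;
* `hclR_toPoly_corr_mulVec` (E6): the correlation operator `U(μ) := Σ_i μ i • (Zᵀ)^i` becomes the
  action: `toPoly (U(μ) v) = act (toPoly μ) (toPoly v)`;
* `hclR_dotProduct_eq_sum_coeff` (E7): `μ ⬝ᵥ v = Σ_{i<N} coeff (toPoly μ) i * coeff (toPoly v) i`.
(E1)–(E3) unfold `degreeLTEquiv`; (E4) is coefficientwise from (E1), `coeff_divX` and the entries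
of `Zᵀ v` (`hclR_shiftT_pow_mulVec` of the Stein module); (E5) is (E4) iterated; (E6) is linearity
in `μ` plus `toPoly μ = Σ_i monomial i (μ i)` (definitional) and
`act (monomial i a) f = a • δ^[i] f`; (E7) reindexes `Fin N ↔ range N` and uses (E1).
-/

-- the problem namespace `…MatrixMultiplication.MatrixMultiplication…` repeats a component by design
set_option linter.dupNamespace false

namespace Summit.MatrixMultiplication.MatrixMultiplication.Theorems

open Polynomial
open scoped Matrix

/-- **(E1)** Coefficients of `toPoly v`: `coeff (toPoly v) i = v i` for `i < N`, and `0` for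
`i ≥ N` (the polynomial lies in `degreeLT ℂ N`). -/
theorem hclR_coeff_toPoly :
    ∀ {N : ℕ} (v : Fin N → ℂ) (i : ℕ), ((((Polynomial.degreeLT ℂ (N)).subtype ∘ₗ
    (Polynomial.degreeLTEquiv ℂ (N)).symm.toLinearMap : (Fin (N) → ℂ) →ₗ[ℂ] Polynomial ℂ))
    v).coeff i = if h : i < N then v ⟨i, h⟩ else 0 := by
  intro N v i
  show (((Polynomial.degreeLTEquiv ℂ N).symm v : Polynomial.degreeLT ℂ N) : ℂ[X]).coeff i = _
  split_ifs with h
  · exact congr_fun ((Polynomial.degreeLTEquiv ℂ N).apply_symm_apply v) ⟨i, h⟩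
  · have hp := Polynomial.mem_degreeLT.mp ((Polynomial.degreeLTEquiv ℂ N).symm v).2
    rw [Polynomial.degree_lt_iff_coeff_zero] at hp
    exact hp i (not_lt.mp h)

/-- **(E2)** `toPoly` is injective (a subtype inclusion after a linear equivalence). -/
theorem hclR_toPoly_injective :
    ∀ {N : ℕ}, Function.Injective (((Polynomial.degreeLT ℂ (N)).subtype ∘ₗ
    (Polynomial.degreeLTEquiv ℂ (N)).symm.toLinearMap : (Fin (N) → ℂ) →ₗ[ℂ] Polynomial ℂ)) := by
  intro N
  exact Subtype.val_injective.comp (Polynomial.degreeLTEquiv ℂ N).symm.injective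

/-- **(E3)** The range of `toPoly` is `degreeLT ℂ N` (the equivalence is onto `degreeLT ℂ N`,
whose inclusion has range `degreeLT ℂ N`). -/
theorem hclR_range_toPoly :
    ∀ {N : ℕ}, LinearMap.range (((Polynomial.degreeLT ℂ (N)).subtype ∘ₗ
    (Polynomial.degreeLTEquiv ℂ (N)).symm.toLinearMap : (Fin (N) → ℂ) →ₗ[ℂ] Polynomial ℂ)) =
    Polynomial.degreeLT ℂ N := by
  intro N
  rw [LinearMap.range_comp, LinearEquiv.range, Submodule.map_top, Submodule.range_subtype]

/-- **(E4)** The up-shift `Zᵀ` of coefficient vectors is the down-shift `divX` of polynomials: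
`toPoly (Zᵀ v) = δ (toPoly v)`.  Coefficientwise both sides are `v (i + 1)` for `i + 1 < N` and
`0` otherwise (by (E1), `coeff_divX` and the entries of `Zᵀ v`). -/
theorem hclR_toPoly_shiftT_mulVec :
    ∀ {N : ℕ} (v : Fin N → ℂ), (((Polynomial.degreeLT ℂ (N)).subtype ∘ₗ
    (Polynomial.degreeLTEquiv ℂ (N)).symm.toLinearMap : (Fin (N) → ℂ) →ₗ[ℂ] Polynomial ℂ))
    (((Matrix.transpose (Matrix.of fun i j : Fin (N) => if (i : ℕ) = (j : ℕ) + 1 then (1 : ℂ)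
    else 0))) *ᵥ v) = Polynomial.divX ((((Polynomial.degreeLT ℂ (N)).subtype ∘ₗ
    (Polynomial.degreeLTEquiv ℂ (N)).symm.toLinearMap : (Fin (N) → ℂ) →ₗ[ℂ] Polynomial ℂ))
    v) := by
  intro N v
  ext i
  rw [Polynomial.coeff_divX, hclR_coeff_toPoly, hclR_coeff_toPoly]
  by_cases h : i < N
  · -- entry `i` of the up-shift `Zᵀ v` (the case `k = 1` of `hclR_shiftT_pow_mulVec`)
    have h1 : ((Matrix.transpose (Matrix.of fun i j : Fin N => if (i : ℕ) = (j : ℕ) + 1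
        then (1 : ℂ) else 0)) *ᵥ v) ⟨i, h⟩ = if h' : i + 1 < N then v ⟨i + 1, h'⟩ else 0 := by
      have := hclR_shiftT_pow_mulVec 1 v ⟨i, h⟩
      rwa [pow_one] at this
    rw [dif_pos h, h1]
  · rw [dif_neg h, dif_neg fun h' => h (Nat.lt_of_succ_lt h')]

/-- **(E5)** Iterating (E4): `toPoly ((Zᵀ)^m v) = δ^[m] (toPoly v)`. -/
theorem hclR_toPoly_shiftT_pow_mulVec :
    ∀ {N : ℕ} (v : Fin N → ℂ) (m : ℕ), (((Polynomial.degreeLT ℂ (N)).subtype ∘ₗ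
    (Polynomial.degreeLTEquiv ℂ (N)).symm.toLinearMap : (Fin (N) → ℂ) →ₗ[ℂ] Polynomial ℂ))
    (((Matrix.transpose (Matrix.of fun i j : Fin (N) => if (i : ℕ) = (j : ℕ) + 1 then (1 : ℂ)
    else 0))) ^ m *ᵥ v) = Polynomial.divX^[m] ((((Polynomial.degreeLT ℂ (N)).subtype ∘ₗ
    (Polynomial.degreeLTEquiv ℂ (N)).symm.toLinearMap : (Fin (N) → ℂ) →ₗ[ℂ] Polynomial ℂ))
    v) := by
  intro N v m
  induction m with
  | zero => simp only [pow_zero, Matrix.one_mulVec, Function.iterate_zero_apply]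
  | succ m ih =>
    rw [pow_succ', ← Matrix.mulVec_mulVec, hclR_toPoly_shiftT_mulVec, ih,
      Function.iterate_succ_apply']

/-- **(E6)** The correlation operator `U(μ) := Σ_i μ i • (Zᵀ)^i` is carried to the action of the
coefficient polynomial: `toPoly (U(μ) v) = act (toPoly μ) (toPoly v)`.  Both sides are linear in
`μ`; on the left `toPoly ((Zᵀ)^i v) = δ^[i] (toPoly v)` by (E5), on the right
`toPoly μ = Σ_i monomial i (μ i)` (definitionally) and `act (monomial i a) f = a • δ^[i] f`. -/
theorem hclR_toPoly_corr_mulVec :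
    ∀ {N : ℕ} (μ v : Fin N → ℂ), (((Polynomial.degreeLT ℂ (N)).subtype ∘ₗ
    (Polynomial.degreeLTEquiv ℂ (N)).symm.toLinearMap : (Fin (N) → ℂ) →ₗ[ℂ] Polynomial ℂ))
    ((∑ i : Fin N, μ i • ((Matrix.transpose (Matrix.of fun i j : Fin (N) => if (i : ℕ) =
    (j : ℕ) + 1 then (1 : ℂ) else 0))) ^ (i : ℕ)) *ᵥ v) = (Polynomial.lsum (fun (i : ℕ) =>
    LinearMap.smulRight (LinearMap.id : ℂ →ₗ[ℂ] ℂ) (Polynomial.divX^[i]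
    ((((Polynomial.degreeLT ℂ (N)).subtype ∘ₗ (Polynomial.degreeLTEquiv ℂ (N)).symm.toLinearMap :
    (Fin (N) → ℂ) →ₗ[ℂ] Polynomial ℂ)) v))) : (Polynomial ℂ) →ₗ[ℂ] (Polynomial ℂ))
    ((((Polynomial.degreeLT ℂ (N)).subtype ∘ₗ (Polynomial.degreeLTEquiv ℂ (N)).symm.toLinearMap :
    (Fin (N) → ℂ) →ₗ[ℂ] Polynomial ℂ)) μ) := by
  intro N μ v
  -- `toPoly μ` is by definition the sum of the monomials `monomial i (μ i)`
  have hμ : (((Polynomial.degreeLT ℂ N).subtype ∘ₗ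
      (Polynomial.degreeLTEquiv ℂ N).symm.toLinearMap : (Fin N → ℂ) →ₗ[ℂ] Polynomial ℂ)) μ =
      ∑ i : Fin N, Polynomial.monomial (i : ℕ) (μ i) := rfl
  rw [hμ, map_sum, Matrix.sum_mulVec, map_sum]
  refine Finset.sum_congr rfl fun i _ => ?_
  rw [Matrix.smul_mulVec, map_smul, hclR_toPoly_shiftT_pow_mulVec, Polynomial.lsum_apply,
    Polynomial.sum_monomial_index]
  · rfl
  · simp

/-- **(E7)** The standard pairing is the coefficient pairing:
`μ ⬝ᵥ v = Σ_{i<N} coeff (toPoly μ) i * coeff (toPoly v) i` (reindex `Fin N ↔ range N`, (E1)). -/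
theorem hclR_dotProduct_eq_sum_coeff :
    ∀ {N : ℕ} (μ v : Fin N → ℂ), μ ⬝ᵥ v = ∑ i ∈ Finset.range N,
    ((((Polynomial.degreeLT ℂ (N)).subtype ∘ₗ (Polynomial.degreeLTEquiv ℂ (N)).symm.toLinearMap :
    (Fin (N) → ℂ) →ₗ[ℂ] Polynomial ℂ)) μ).coeff i * ((((Polynomial.degreeLT ℂ (N)).subtype ∘ₗ
    (Polynomial.degreeLTEquiv ℂ (N)).symm.toLinearMap : (Fin (N) → ℂ) →ₗ[ℂ] Polynomial ℂ))
    v).coeff i := by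
  intro N μ v
  rw [dotProduct, ← Fin.sum_univ_eq_sum_range]
  refine Finset.sum_congr rfl fun i _ => ?_
  rw [hclR_coeff_toPoly, hclR_coeff_toPoly, dif_pos i.2, dif_pos i.2]

end Summit.MatrixMultiplication.MatrixMultiplication.Theorems
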